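import Summits.BirchSwinnertonDyer.BirchSwinnertonDyer.Theorems.KatoDescentTamePotSupersingularJetchevIrreducibleProp44AHalfConcrete
import Summits.BirchSwinnertonDyer.BirchSwinnertonDyer.Theorems.Rank1ResidualJetKolyvaginClassLocal
import Summits.BirchSwinnertonDyer.BirchSwinnertonDyer.Theorems.KolyvaginRoadThreePointCertificate
import Summits.BirchSwinnertonDyer.Rank1Residual.X11b.RingClassFieldNoTorsionOfIrreducible
import Summits.BirchSwinnertonDyer.Rank1Residual.X11b.SplitPrimeUnramified
import Literature.NumberTheory.EllipticCurves.WeilPairingProofs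
import Literature.NumberTheory.EllipticCurves.HeegnerPointsOfConductorRationalityProofs
import Literature.NumberTheory.EllipticCurves.RingClassGalOverCyclicProofs
import HarnessLib

/-!
# Crux `JetchevIrreducibleReadingByName` (item 20165, shared K8-t′ / K9), stub S5 `stub_prop44Irred` — the
# (A)-conjunct `ord d_M(c)_λ = ord c_M(c)_λ` UNCONDITIONAL on the crux's rows: `E[p]` irreducible, `p ∣ N_E`, `K` a
# Heegner field with `d_K ∉ {−3,−4}` (the standing inputs `hA`, `hPt` of the concrete class DISCHARGED) — seat
# `bsd-potss-k8t-c4` g10; `--supports 20165`, helper; route-free; nothing booked, no item closed, BSD is not proved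

WHAT. `zsmul_kolyvaginClass_mem_torsionLocalKer_of_mem_selmerLocalKer` (sibling file `…Prop44AHalfConcrete`, this seat
p529624) proves the (A)-conjunct of S5 for the tree's concrete Kolyvagin classes modulo the class's two standing inputs:
`hA` (admissibility of `E(K[c]) ⊆ E(K̄)` for `p^M`: `Γ_K`-stable, no `p`-torsion — Gross Lemma 4.3 / McCallum (5)) and
`hPt` (`[P(c)]` is `Γ_K`-invariant mod `p^M` — Gross Prop. 3.6 with (4.1)). On the rows of crux 20165 both are TREE
THEOREMS: `hA` from IRREDUCIBILITY by x11b3's `NoTorsionIrr.isAdmissible_pointsSubgroup_of_hasIrreducibleModPGaloisRep`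
(Weil pairing — PROVED, `exists_weilPairing_holds` —, `p` unramified in `K` — from the Heegner hypothesis at `p ∣ N_E`,
`X11b.isUnramifiedIn_of_satisfiesHeegnerHypothesis_of_dvd` —, `p ∤ c`); `hPt` by the Zhang-currency point certificate
`KolyCert.toGeomPoints_derivedPoint_mem_invPoints_of_dvd_zhang` (Gross Prop. 3.6 from the PROVED trace relation
Prop. 3.7 (1)) on the coherent concrete family through the divisors of `c` (data at every divisor by the PROVED
Gross §3 CM facts, `nonempty_kolyvaginHeegnerData_of_grossCM`). Result: **for `W/ℚ` globally minimal, `K` Heegner for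
`N_E` with `d_K ∉ {−3,−4}`, `p` odd with `E[p]` irreducible and `p ∣ N_E`, a square-free Zhang–Kolyvagin level `c` of
index `≥ M`, a prime `ℓ ∣ c`, the place `λ ∋ ℓ`, ANY concrete datum `d` at level `c` and any `k`:
`k · c_M(c) ∈ Sel_λ ↔ k · c_M(c) ∈ Ker_λ`** — i.e. on the crux's rows the registered stub S5 REDUCES TO ITS
(B)-CONJUNCT (Jetchev Prop. 4.7's order comparison `ord c_M(cℓ)_λ = ord c_M(c)_λ`), which is what every consumer
uses. No CM hypothesis. HONEST FRAMING: (B) untouched (rests on Gross Prop. 3.7 (2)); the crux, S5 and BSD stay open.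

References: [cite: McCallumLMS1991, §4 (5), Lemma 4.3, Prop. 4.4 (1)(3) (p. 301)] [cite: GrossLMS1991, §3 Prop. 3.6,
Prop. 3.7 (1), §4 Lemma 4.3, (4.1)] [cite: Jetchev2008, Prop. 4.7, Rem. 6.2] [cite: Howard2004HeegnerKolyvagin, Lemma 2.7.3]
[cite: WZhang2014, Notations (xii)].
-/

set_option autoImplicit false
-- the Theorems directory repeats the summit name (sibling precedent `KatoDescentPotSupersingularAssembly.lean`)
set_option linter.dupNamespace false

noncomputable section

open scoped Classical Pointwise

open WeierstrassCurve NumberField IsDedekindDomain Field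
  Literature.NumberTheory.GaloisRepresentations Literature.NumberTheory.EllipticCurves
  Literature.NumberTheory.EllipticCurves.KolyvaginCocycle Literature.NumberTheory.EllipticCurves.ModularForms
  Summit.BirchSwinnertonDyer.Rank1Residual Summit.BirchSwinnertonDyer.Rank1Residual.X11b
  Summit.BirchSwinnertonDyer.Rank1Residual.X11b.Three

namespace Summit.BirchSwinnertonDyer.BirchSwinnertonDyer.Theorems.JetchevIrreducibleProp44

-- `K : Type`: the tree's ring-class class field theory is universe `0`.
variable {K : Type} [Field K] [NumberField K]

/-- **The standing inputs `hA`, `hPt` of the concrete Kolyvagin class on the crux's rows** (`E[p]` irreducible,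
`p ∣ N_E`, Heegner field with `d_K ∉ {−3,−4}`, Zhang–Kolyvagin level `c` of index `≥ M`): admissibility of
`E(K[c]) ⊆ E(K̄)` for `p^M` (x11b3's irreducible no-torsion theorem) and `Γ_K`-invariance of `[P(c)]` mod `p^M`
(KolyCert's Zhang-currency certificate over the coherent concrete family, Gross §3 CM facts PROVED).
[cite: GrossLMS1991, Lemma 4.3, Prop. 3.6] [cite: McCallumLMS1991, §4 (4), (5)] -/
theorem isAdmissible_and_mem_invPoints_of_irreducible_of_heegner (hK : IsImaginaryQuadratic K) (ι : K →+* ℂ)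
    (W : WeierstrassCurve ℚ) [W.IsElliptic] [W.IsGloballyMinimal] [NeZero (W.conductorNorm ℤ)]
    (hD3 : NumberField.discr K ≠ -3) (hD4 : NumberField.discr K ≠ -4)
    (hH : SatisfiesHeegnerHypothesis (W.conductorNorm ℤ) K)
    {p : ℕ} [Fact p.Prime] (hp2 : p ≠ 2) (hirr : W.HasIrreducibleModPGaloisRep p) (hpN : p ∣ W.conductorNorm ℤ)
    (Dt : ModularParametrizationData W (W.conductorNorm ℤ)) (β : ℤ) {M : ℕ}
    {c : ℕ} (hc : Squarefree c)
    (hKol : ∀ q ∈ c.primeFactors, Zhang2014.IsKolyvaginPrime (W.conductorNorm ℤ) W K p q ∧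
      M ≤ Zhang2014.kolyvaginIndex W p q)
    (d : KolyvaginHeegnerData Dt β ι c) :
    IsAdmissible (absoluteGaloisGroup K) d.pointsSubgroup ((p ^ M : ℕ) : ℤ) ∧
      d.toGeomPoints d.derivedPoint ∈ invPoints (absoluteGaloisGroup K) d.pointsSubgroup ((p ^ M : ℕ) : ℤ) := by
  have hp : p.Prime := Fact.out
  have hc0 : c ≠ 0 := hc.ne_zero
  -- `p ∤ c` (Kolyvagin primes are `≠ p`)
  have hpc : ¬ p ∣ c := fun h ↦
    (hKol p (Nat.mem_primeFactors.mpr ⟨hp, h, hc0⟩)).1.2.2.2.1 rfl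
  refine ⟨?_, ?_⟩
  · -- `hA` from irreducibility
    exact NoTorsionIrr.isAdmissible_pointsSubgroup_of_hasIrreducibleModPGaloisRep d hK hc0 hp hp2 hirr
      (WeierstrassCurve.exists_weilPairing_holds W p)
      (X11b.isUnramifiedIn_of_satisfiesHeegnerHypothesis_of_dvd hK hH hp hpN) hpc M
  · -- `hPt` from the point certificate over the coherent family through the divisors of `c`
    have hND : IsCoprime (W.conductorNorm ℤ : ℤ) (NumberField.discr K) :=
      KolyvaginAssembly.isCoprime_discr_of_satisfiesHeegnerHypothesis hK hH
    have hD : NumberField.discr K < -4 := KolyvaginAssembly.discr_lt_neg_four hK ⟨hD3, hD4⟩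
    have hinert : ∀ (m' : ℕ), m' ∣ c → ∀ q ∈ m'.primeFactors, (Ideal.span {(q : 𝓞 K)}).IsPrime :=
      fun m' hm' q hq ↦ (hKol q (Nat.primeFactors_mono hm' hc0 hq)).1.2.2.2.2.1
    have hne : ∀ m' : ℕ, m' ∣ c → Nonempty (KolyvaginHeegnerData Dt β ι m') := fun m' hm' ↦
      BirchSwinnertonDyer.Theorems.nonempty_kolyvaginHeegnerData_of_grossCM
        (phi_heegnerPointOfConductor_mem_range_map_ringClassField_holds (W.conductorNorm ℤ) W K)
        exists_generator_ringClassGalOver_holds hK hH Dt β ι d.dvd_sq_sub (hc.squarefree_of_dvd hm')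
        (hinert m' hm')
    let data : (m' : ℕ) → m' ∣ c → KolyvaginHeegnerData Dt β ι m' := fun m' hm' ↦
      if h : m' = c then h ▸ d else (hne m' hm').some
    have hdata : data c dvd_rfl = d := by simp [data]
    have h := KolyCert.toGeomPoints_derivedPoint_mem_invPoints_of_dvd_zhang hK ι Dt hp hND hD hc hKol data c
      dvd_rfl
    rwa [hdata] at h

/-- **McCallum Prop. 4.4 "`ord d_M(c)_λ = ord c_M(c)_λ`" — the (A)-conjunct of S5 — UNCONDITIONAL on the crux's rows**
(`E[p]` irreducible, `p ∣ N_E`, `K` Heegner for `N_E` with `d_K ∉ {−3,−4}`): for every concrete datum `d` at a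
square-free Zhang–Kolyvagin level `c` of index `≥ M`, every prime `ℓ ∣ c`, the place `λ ∋ ℓ` and every `k : ℤ`,
`k · c_M(c) ∈ selmerLocalKer λ ↔ k · c_M(c) ∈ torsionLocalKer λ`. No hypothesis on the image beyond irreducibility,
none on the reduction of `E` at `p` beyond `p ∣ N_E` (used only for `p` unramified in `K`), no CM hypothesis.
[cite: McCallumLMS1991, Prop. 4.4 (1)(3) (p. 301)] [cite: Jetchev2008, Prop. 4.7, Rem. 6.2]
[cite: Howard2004HeegnerKolyvagin, Lemma 2.7.3] -/
theorem zsmul_kolyvaginClass_mem_selmerLocalKer_iff_mem_torsionLocalKer_of_irreducible_of_heegner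
    (hK : IsImaginaryQuadratic K) (ι : K →+* ℂ) [∀ j : ℕ, NumberField (ringClassField K ι j)]
    (W : WeierstrassCurve ℚ) [W.IsElliptic] [W.IsGloballyMinimal] [NeZero (W.conductorNorm ℤ)]
    (hD3 : NumberField.discr K ≠ -3) (hD4 : NumberField.discr K ≠ -4)
    (hH : SatisfiesHeegnerHypothesis (W.conductorNorm ℤ) K)
    {p : ℕ} [Fact p.Prime] (hp2 : p ≠ 2) (hirr : W.HasIrreducibleModPGaloisRep p) (hpN : p ∣ W.conductorNorm ℤ)
    (Dt : ModularParametrizationData W (W.conductorNorm ℤ)) (β : ℤ) {M : ℕ}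
    {c ℓ : ℕ} (hc : Squarefree c) (hℓc : ℓ ∈ c.primeFactors)
    (hKol : ∀ q ∈ c.primeFactors, Zhang2014.IsKolyvaginPrime (W.conductorNorm ℤ) W K p q ∧
      M ≤ Zhang2014.kolyvaginIndex W p q)
    (d : KolyvaginHeegnerData Dt β ι c)
    (v : HeightOneSpectrum (𝓞 K)) (hv : (ℓ : 𝓞 K) ∈ v.asIdeal) (k : ℤ) :
    k • d.kolyvaginClass (Fact.out : p.Prime) M ∈
        selmerLocalKer (W.baseChange K) (v.adicCompletion K) ((p ^ M : ℕ) : ℤ) ↔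
      k • d.kolyvaginClass (Fact.out : p.Prime) M ∈
        (W.baseChange K).torsionLocalKer (v.adicCompletion K) ((p ^ M : ℕ) : ℤ) := by
  obtain ⟨hA, hPt⟩ := isAdmissible_and_mem_invPoints_of_irreducible_of_heegner hK ι W hD3 hD4 hH hp2 hirr hpN
    Dt β hc hKol d
  exact zsmul_kolyvaginClass_mem_selmerLocalKer_iff_mem_torsionLocalKer hK ι W hp2 hc hℓc
    (fun q hq ↦ (hKol q hq).1) (hKol ℓ hℓc).2 d hA hPt v hv k

end Summit.BirchSwinnertonDyer.BirchSwinnertonDyer.Theorems.JetchevIrreducibleProp44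

end
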